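import Literature.Computability.AlgebraicComplexity.DDS21DiDILExactChain
import Literature.Computability.AlgebraicComplexity.DDS21DiDILStep
import Literature.Computability.AlgebraicComplexity.DDS21StageZeroRegularForms
import HarnessLib

/-!
# DDS21 Thm. 3.2 (de-bordering `Σ^{[k]}ΠΣ`): the DiDIL transcript on the `F(x)` side —
# §1 the STAGE-0 instantiation (input circuit ⇒ shifted forms ⇒ exact terms with a limit),
# §2 the DiDIL RUN (rounds, divisors, unit data, chain equations, towers, end state)

Theorem-only file (cell `val-lit`, np lane, DDS21 Thm 3.2 programme "M-b", lead-np RULINGS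
(149)(b)/(150)(d): "transcript existence, `F(x)` side"). Source: P. Dutta, P. Dwivedi, N. Saxena,
*Demystifying the border of depth-3 algebraic circuits*, FOCS 2021, full version
`paper:galaxy-pdf-7641649743695546420` (chunk `pNNNN.txt`, printed line `Lnnn`), §3 proof of
Thm. 3.2, base case (p0028 L745–757), the induction (p0030 L797–812), Claims 3.4–3.6 (p0029 L772 –
p0033 L890) [DuttaDwivediSaxena2022].

Architecture of record (A′) (RULING (143)(b)): the printed random point `α ∈ Fⁿ` ("`Φ : x_i ↦
z·x_i + α_i`, `α_i` random elements of `F`", p0028 L751–754) is the tuple `y` of indeterminates of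
`F′ = F(y)`; the input `f ∈ \overline{Σ^{[k]}Π^{[d]}Σ}` over `F` is read over `F′`
(`mem_border_spsClass_baseChange`, `DDS21BorderBaseChange.lean`), SHIFTED by `y` (the shifted forms
are `ε`-regular: `exists_regular_of_shift`, `DDS21GenericShiftRegular.lean`), and the DiDIL
induction is run over `F′(ε)` on the exact objects of `DDS21DiDILStep.lean` (brick B4b) with limits
in the graded frame `F′(x)` (`DDS21EpsIntegralFractions.lean`, `DDS21DiDILExactChain.lean`); the
dilation `x ↦ z·x` (`DDS21TranscriptDilation.lean`) then produces the `z`-frame transcript consumed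
by the trace-back (`DDS21TraceBackAssembly.lean`).

## Contents of §1 (all PROVED; 0 definitions, 0 named facts)

* `affForm` bookkeeping: `coeff_single_affForm`, `affForm_eq_zero_iff` (a form vanishes iff its
  coefficient data vanish); an `ε`-regular form — the shape `a = c·ι(b)`, `c ≠ 0`, `b_∅(0) ≠ 0` of
  `DDS21DiDILEndGame.lean` — has a nonzero constant coefficient: `none_ne_zero_of_regular` of
  `DDS21StageZeroRegularForms.lean` (p2 g11; decl of record, lead-np RULINGS (161)/(162)), used by name.
* `exists_forms_of_mem_border`: `f ∈ \overline{Σ^{[k]}Π^{[d]}Σ}` unfolded into coefficient data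
  `T : Fin k → Fin d → (Option (Fin n) → F(ε))` with `f = lim_{ε→0} ∑_i ∏_j ℓ_{T i j}` (Def. 2.1).
* `bind₁_shift_affForm'`, `bind₁_shift_prod_affForm`: the shift `x ↦ x + y` acts on affine forms by
  `ℓ_a(x + y) = ℓ_{a♯}(x)`, `a♯_∅ = a_∅ + ∑_m a_m y_m`, `a♯_m = a_m` ("`Ψ(T_{i,0})`", p0028 L753;
  `affForm` currency of `bind₁_shift_affForm`, `DDS21GenericShiftRegular.lean`).
* ★ `exists_shiftedForms`: base change along `φ : F → F′` and shift by `y ∈ F′ⁿ` of the input: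
  forms `T` over `F(ε)` approximating `f` and forms `T♯` over `F′(ε)` — given by the two
  characterising equations above, VERBATIM the hypotheses `hnone`/`hsome` of the `ε`-regularity
  lemma of `DDS21GenericShiftRegular.lean` (p2 g11) — approximating `f^φ(x + y)`.
* `dilate_shift_eq_phi`: dilating the shifted polynomial is the printed `Φ_y(f) = f(z·x + y)`
  (the field `hN0` of the trace-back transcript).
* ★ `exists_stageZero_epsLim` (+ `_of_regular`): the STAGE-0 family of the DiDIL induction — from
  forms `T` over `K(ε)` whose nonzero members have nonzero constant coefficient and
  `f = lim ∑_i ∏_j ℓ_{T i j}`: `m ≤ k` well-formed nondegenerate exact terms of size `≤ d` with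
  trivial `Σ∧Σ` certificates (B4b `exists_stageZero`) whose value sum has the limit `f` in `K(x)`
  (`EpsLim`, the input `h0` of the exact chain `epsLim_chain_of_scaledRaw`).

## Contents of §2 (all PROVED; 0 definitions, 0 named facts)

* `didil_round`: ONE round on exact objects with limits — divisor `G i₀ = c·U` (`exists_unit_divisor`),
  the Claim-3.8 datum `lim (λc · (Σ_i G_i)/G_{i₀}) = f/u`, and `lim (λc · Σ_i E(G_i/G_{i₀})) = E(f/u)`
  (B4b `sum_val_didilStep_euler`, E1 `EpsLim.div`/`.eulerFrac`).
* ★ `exists_didil_run`: the RUN from any certified family with a scaled limit — `r ≤ m − 1` rounds,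
  per round (BY NAME) the stage family and divisor index, unit data, `λ_{j+1} = λ_j c_j`,
  `f_{j+1} = E(f_j/u_j)`, the Claim-3.8 datum, the towers `B_{j+1} = 20 B_j`,
  `t_{j+1} = (4B_j+2)N⁸t_j⁴` (Claim 3.6), the invariants and `lim (λ_j Σ_i (Fam j)_i) = f_j` at every
  stage, and the END STATE (one term left — the input of `ExactTerm.uabp_residue`, Claim 3.3 — or
  `f_r = 0`); `exists_didil_run_stageZero`: the run from the stage-0 family of §1 (`λ_0 = 1`,
  `B_0 = d`, `t_0 = 1`, `r ≤ k − 1`).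

What is NOT here (later sections / other seats): programs for the divisor representatives and the
top pair (`DDS21DiDILEndGame.lean`, t19 g12, applied to the divisor terms / the end state recorded
here), the graded valuation of the divisors and the Claim-3.8 models (`DDS21DiDILCompanion.lean`,
t21 g13, applied to the stage families recorded here), the slice bridge (t18 g11), the budget
closing (p2 g11), the `ε`-regularity of the shifted forms (p2 g11, `DDS21GenericShiftRegular.lean`),
the `z`-frame conversion and the final assembly (p1 g10). Honest framing: bookkeeping of a KNOWN
proof; `DDS2021_thm_3_2` stays OPEN by name; VP ≠ VNP is NOT proved and nothing here bears on it.

## References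

* [DuttaDwivediSaxena2022] P. Dutta, P. Dwivedi, N. Saxena, *Demystifying the border of depth-3
  algebraic circuits*, Proc. 62nd FOCS (2021), IEEE 2022, 92–103; full version §3 proof of
  Thm. 3.2: base case p0028 L745–757, induction p0030 L797–812, Claim 3.4 p0029 L772–785,
  Claim 3.5 p0031 L815–845, Claim 3.6 p0033 L873–890, Claim 3.3 / end of the induction p0033
  L891 – p0034 L897; Def. 2.1 p0016 L416–419.
-/

noncomputable section

open MvPolynomial
open scoped BigOperators Polynomial

namespace Literature.Computability.AlgebraicComplexity

namespace DDS2021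

/-! ## §1.1 Affine forms: coefficients and vanishing -/

section Forms

variable {K : Type*} [Field K] {n : ℕ}

/-- The coefficient of `x_m` in `ℓ_a = a_∅ + ∑_m a_m x_m` is `a_m`.
[cite: DuttaDwivediSaxena2022, Def. 3.1 (full version p0026 L702–707)] -/
theorem coeff_single_affForm (a : Option (Fin n) → K) (m : Fin n) :
    coeff (Finsupp.single m 1) (affForm a) = a (some m) := by
  classical
  rw [affForm, coeff_add, coeff_C, if_neg (Finsupp.single_ne_zero.mpr one_ne_zero).symm, zero_add,
    coeff_sum, Finset.sum_eq_single m]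
  · rw [coeff_C_mul, coeff_X, if_pos rfl, mul_one]
  · intro m' _ hm'
    rw [coeff_C_mul, coeff_X, if_neg (fun h => hm' (Finsupp.single_left_injective one_ne_zero h)),
      mul_zero]
  · intro h
    exact absurd (Finset.mem_univ m) h

/-- An affine form vanishes iff all its coefficient data vanish.
[cite: DuttaDwivediSaxena2022, Def. 3.1 (full version p0026 L702–707)] -/
theorem affForm_eq_zero_iff (a : Option (Fin n) → K) : affForm a = 0 ↔ a = 0 := by
  constructor
  · intro h
    funext o
    cases o with
    | none => rw [← coeff_zero_affForm a, h, coeff_zero, Pi.zero_apply]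
    | some m => rw [← coeff_single_affForm a m, h, coeff_zero, Pi.zero_apply]
  · rintro rfl
    simp [affForm]

end Forms

/-! ## §1.2 The input circuit as coefficient data; base change and the shift `x ↦ x + y` -/

section Shift

variable {F F' : Type*} [Field F] [Field F'] {n : ℕ}

/-- **`f ∈ \overline{Σ^{[k]}Π^{[d]}Σ}` unfolded**: coefficient data `T i j` of the `k·d` affine forms
of an approximating circuit, `f = lim_{ε→0} ∑_i ∏_j ℓ_{T i j}` in the sense of Def. 2.1.
[cite: DuttaDwivediSaxena2022, Def. 2.1 and Thm. 3.2 (full version p0016 L416–419, p0026 L710–717)] -/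
theorem exists_forms_of_mem_border {k d : ℕ} {f : MvPolynomial (Fin n) F}
    (hf : f ∈ border (spsClass (RatFunc F) n k d)) :
    ∃ T : Fin k → Fin d → Option (Fin n) → RatFunc F,
      MS2021.IsEpsApprox f (∑ i, ∏ j, affForm (T i j)) := by
  obtain ⟨g, ⟨T, hg⟩, hfg⟩ := hf
  refine ⟨T, ?_⟩
  rw [hg] at hfg
  exact hfg

/-- **The shift on one affine form**, in `affForm` currency (the identity is
`bind₁_shift_affForm` of `DDS21GenericShiftRegular.lean`): `ℓ_a(x + y) = ℓ_{a♯}(x)` with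
`a♯_∅ = a_∅ + ∑_m a_m·y_m`, `a♯_m = a_m`.
[cite: DuttaDwivediSaxena2022, §3 proof of Thm. 3.2, "`Φ : x_i ↦ z·x_i + α_i`" (full version p0028 L751–754)] -/
theorem bind₁_shift_affForm' {K : Type*} [Field K] (y : Fin n → K) (a : Option (Fin n) → K) :
    bind₁ (fun i : Fin n => (X i + C (y i) : MvPolynomial (Fin n) K)) (affForm a) =
      affForm (fun o : Option (Fin n) => o.elim (a none + ∑ m, a (some m) * y m) fun m => a (some m)) :=
  bind₁_shift_affForm y a

/-- The shift on a product of affine forms. [cite: DuttaDwivediSaxena2022, §3 proof of Thm. 3.2, "`Ψ(T_{i,0})`" (full version p0028 L751–754)] -/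
theorem bind₁_shift_prod_affForm {K : Type*} [Field K] (y : Fin n → K) {d : ℕ}
    (a : Fin d → Option (Fin n) → K) :
    bind₁ (fun i : Fin n => (X i + C (y i) : MvPolynomial (Fin n) K)) (∏ j, affForm (a j)) =
      ∏ j, affForm (fun o : Option (Fin n) =>
        o.elim (a j none + ∑ m, a j (some m) * y m) fun m => a j (some m)) := by
  rw [map_prod]
  exact Finset.prod_congr rfl fun j _ => bind₁_shift_affForm' y (a j)

/-- Affine forms under a coefficient map, in `affForm` currency (`map_affineForm`).
[cite: DuttaDwivediSaxena2022, §1.1 (full version p0006 L120–121)] -/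
theorem map_affForm' {K K' : Type*} [Field K] [Field K'] (ψ : K →+* K') (a : Option (Fin n) → K) :
    map ψ (affForm a) = affForm (fun o => ψ (a o)) :=
  map_affineForm ψ a

/-- ★ **Base change and shift of the input circuit** (the (A′) reading of "apply `Φ`, `α` random"):
for `f ∈ \overline{Σ^{[k]}Π^{[d]}Σ}` over `F`, a field map `φ : F → F′` and a point `y ∈ F′ⁿ`, there
are coefficient data `T` over `F(ε)` with `f = lim ∑_i ∏_j ℓ_{T i j}`, and SHIFTED data `T♯` over
`F′(ε)` — `T♯ i j ∅ = φ(T i j ∅) + ∑_m φ(T i j m)·y_m`, `T♯ i j m = φ(T i j m)` (VERBATIM the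
hypotheses `hnone`/`hsome` of the `ε`-regularity lemma of `DDS21GenericShiftRegular.lean`) — with
`f^φ(x + y) = lim ∑_i ∏_j ℓ_{T♯ i j}` (Def. 2.1 is stable under base change and `F′`-substitutions).
[cite: DuttaDwivediSaxena2022, §3 proof of Thm. 3.2, "`Φ : x_i ↦ z·x_i + α_i` … `Ψ(T_{i,0})`" (full version p0028 L751–757); Def. 2.1 (p0016 L416–419)] -/
theorem exists_shiftedForms (φ : F →+* F') (y : Fin n → F') {k d : ℕ} {f : MvPolynomial (Fin n) F}
    (hf : f ∈ border (spsClass (RatFunc F) n k d)) :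
    ∃ (T : Fin k → Fin d → Option (Fin n) → RatFunc F)
      (Ts : Fin k → Fin d → Option (Fin n) → RatFunc F'),
      MS2021.IsEpsApprox f (∑ i, ∏ j, affForm (T i j)) ∧
      (∀ i j, Ts i j none = ratFuncMap φ (T i j none) +
        ∑ m, ratFuncMap φ (T i j (some m)) * algebraMap F' (RatFunc F') (y m)) ∧
      (∀ i j m, Ts i j (some m) = ratFuncMap φ (T i j (some m))) ∧
      MS2021.IsEpsApprox (aeval (fun i : Fin n => (X i + C (y i) : MvPolynomial (Fin n) F')) (map φ f))
        (∑ i, ∏ j, affForm (Ts i j)) := by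
  obtain ⟨T, hT⟩ := exists_forms_of_mem_border hf
  refine ⟨T, fun i j o => o.elim (ratFuncMap φ (T i j none) +
      ∑ m, ratFuncMap φ (T i j (some m)) * algebraMap F' (RatFunc F') (y m))
    fun m => ratFuncMap φ (T i j (some m)), hT, fun _ _ => rfl, fun _ _ _ => rfl, ?_⟩
  -- base change along `φ`, then the `F′`-substitution `x ↦ x + y`
  have h1 := (isEpsApprox_baseChange φ hT).bind₁_algebraMap
    (fun i : Fin n => (X i + C (y i) : MvPolynomial (Fin n) F'))
  rw [aeval_eq_bind₁]
  convert h1 using 1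
  rw [map_sum, map_sum]
  refine Finset.sum_congr rfl fun i _ => ?_
  rw [map_prod, map_prod]
  refine Finset.prod_congr rfl fun j _ => ?_
  rw [map_affForm']
  simp only [map_add, map_X, map_C]
  rw [bind₁_shift_affForm']

/-- **Dilating the shifted polynomial is `Φ_y`**: `(f(x + y))(z·x) = f(z·x + y)` — the field `hN0`
of the trace-back transcript (`N_0 = Φ_α(f)`, `α := y`).
[cite: DuttaDwivediSaxena2022, §3 proof of Thm. 3.2, "`Φ : x_i ↦ z·x_i + α_i`" (full version p0028 L751–757)] -/
theorem dilate_shift_eq_phi {K : Type*} [CommRing K] (y : Fin n → K) (f : MvPolynomial (Fin n) K) :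
    bind₁ (fun i : Fin n => (X 0 * X i.succ : MvPolynomial (Fin (n + 1)) K))
        (aeval (fun i : Fin n => (X i + C (y i) : MvPolynomial (Fin n) K)) f) =
      aeval (fun i : Fin n => (X 0 * X i.succ + C (y i) : MvPolynomial (Fin (n + 1)) K)) f := by
  rw [← AlgHom.comp_apply]
  refine AlgHom.congr_fun (MvPolynomial.algHom_ext fun i => ?_) f
  simp only [AlgHom.comp_apply, aeval_X, map_add, bind₁_X_right, bind₁_C_right]

end Shift

/-! ## §1.3 Stage 0 of the DiDIL induction: exact terms with a limit -/

section StageZero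

variable {K : Type*} [Field K] {n : ℕ}

/-- ★ **Stage 0 of the DiDIL induction, instantiated.** If the nonzero forms among `ℓ_{T i j}`
(`T` over `K(ε)`) have nonzero constant coefficients ("`Ψ(T_{i,0})|_{x=0} = T_{i,0}(α) ≠ 0`") and
`f = lim_{ε→0} ∑_i ∏_j ℓ_{T i j}` (Def. 2.1), then the base-case family of B4b
(`exists_stageZero`: "`U_{i,0} := T_{i,0}`, `V_{i,0} := P_{i,0} := Q_{i,0} := 1`", live products
only) consists of `m ≤ k` well-formed, nondegenerate exact terms of size `≤ d` with trivial `Σ∧Σ`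
certificates whose value sum `g_0` HAS THE LIMIT `f` in `K(x)` ("`g_0` approximates `f_0`"; the
input `h0` of the exact chain `epsLim_chain_of_scaledRaw` of `DDS21DiDILExactChain.lean`).
[cite: DuttaDwivediSaxena2022, §3 proof of Thm. 3.2, base case (full version p0028 L745–757); Claim 3.4 (p0029 L772–785)] -/
theorem exists_stageZero_epsLim {k d : ℕ} (T : Fin k → Fin d → Option (Fin n) → RatFunc K)
    (h0 : ∀ i j, affForm (T i j) ≠ 0 → T i j none ≠ 0) {f : MvPolynomial (Fin n) K}
    (hf : MS2021.IsEpsApprox f (∑ i, ∏ j, affForm (T i j))) :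
    ∃ (m : ℕ) (G : Fin m → ExactTerm (RatFunc K) n), m ≤ k ∧
      (∀ i, (G i).WF ∧ (G i).ND ∧ (G i).Bdd d ∧ ∀ N, (G i).Cert N 1) ∧
      EpsLim (∑ i, (G i).val) (limToFrac K (Fin n) f) := by
  obtain ⟨m, G, hm, hG, hsum⟩ := exists_stageZero T h0
  refine ⟨m, G, hm, hG, ?_⟩
  rw [hsum]
  exact epsLim_algebraMap_of_isEpsApprox hf

/-- Stage 0 from `ε`-REGULAR forms (the hypothesis shape `ha` of `DDS21DiDILEndGame.lean`,
delivered for the shifted forms `T♯` of `exists_shiftedForms` by `DDS21GenericShiftRegular.lean`).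
[cite: DuttaDwivediSaxena2022, §3 proof of Thm. 3.2, base case (full version p0028 L745–757)] -/
theorem exists_stageZero_epsLim_of_regular {F : Type*} [Field F] {k d : ℕ}
    (T : Fin k → Fin d → Option (Fin n) → RatFunc F)
    (hreg : ∀ i j, affForm (T i j) ≠ 0 → ∃ (c : RatFunc F) (b : Option (Fin n) → F[X]), c ≠ 0 ∧
      (∀ o, T i j o = c * algebraMap F[X] (RatFunc F) (b o)) ∧ (b none).coeff 0 ≠ 0)
    {f : MvPolynomial (Fin n) F} (hf : MS2021.IsEpsApprox f (∑ i, ∏ j, affForm (T i j))) :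
    ∃ (m : ℕ) (G : Fin m → ExactTerm (RatFunc F) n), m ≤ k ∧
      (∀ i, (G i).WF ∧ (G i).ND ∧ (G i).Bdd d ∧ ∀ N, (G i).Cert N 1) ∧
      EpsLim (∑ i, (G i).val) (limToFrac F (Fin n) f) :=
  exists_stageZero_epsLim T (fun i j h => none_ne_zero_of_regular (hreg i j h)) hf

/-- The limit of the stage-0 sum, pushed to the `z`-frame origin: `lim g_0 = f♯` read through
`limToFrac` is the polynomial `f♯` itself, so `dilFrac (lim g_0) = Φ_y(f)` by `dilate_shift_eq_phi`
(bookkeeping for the field `hg0` of the link lemma). [cite: DuttaDwivediSaxena2022, Claim 3.4 (full version p0029 L777–779)] -/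
theorem limToFrac_shift_eq (y : Fin n → K) (f : MvPolynomial (Fin n) K) :
    limToFrac K (Fin n) (aeval (fun i : Fin n => (X i + C (y i) : MvPolynomial (Fin n) K)) f) =
      algebraMap (MvPolynomial (Fin n) K) (FractionRing (MvPolynomial (Fin n) K))
        (bind₁ (fun i : Fin n => (X i + C (y i) : MvPolynomial (Fin n) K)) f) := by
  rw [aeval_eq_bind₁]
  rfl

end StageZero

/-! ## §2 The DiDIL RUN (rounds `j < r`): divisors, unit data, chain equations, towers, end state

The induction "Reducing `Gen(k − j, ·)` to `Gen(k − j − 1, ·)`" (p0030 L797–812) on B4b's exact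
objects, driven as follows: while at least two terms are present and some term is NONDEGENERATE,
divide by such a term (any nonzero term may serve, `ExactTerm.val_eq_zero_iff`; the printed
"minimal valuation" choice is immaterial for the identities) and derive with the Euler derivation
(graded frame); stop when one term is left (the input of the end game, Claim 3.3 at the last stage)
or when every remaining term is degenerate (then the residue is `0`). The `ε`-side bookkeeping is
the SCALED-RAW convention of `DDS21DiDILExactChain.lean` §4: the divisor `T = c·U` with `U` an
`ε`-unit (`exists_unit_divisor`), the scalar `λ_{j+1} = λ_j·c_j`, `lim (λ_j · Σ_i T_{i,j}) = f_j`,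
`f_{j+1} = E(f_j / u_j)` (Claims 3.4 / 3.5(ii)). Recorded per round, BY NAME for the consumers: the
stage family and the divisor index (for the `ε`-regularity / companion invariants of
`DDS21DiDILStep.lean` v3 and `DDS21DiDILCompanion.lean`, and for `ExactTerm.uabp_residue` of
`DDS21DiDILEndGame.lean` on the divisor term), the unit data, the chain equation, the datum
`lim (s · (Σ_i T_i)/T_{i₀}) = f_j/u_j` of Claim 3.8 (input of `epsLim_gradeZero_stage`), and the
size/certificate towers `B_{j+1} = 20·B_j`, `t_{j+1} = (4B_j + 2)·N⁸·t_j⁴` (Claim 3.6). -/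

section Run

variable {F : Type*} [Field F] {n : ℕ}

/-- **One DiDIL round on exact objects, with limits ("Divide and Derive", (3.2); Claims 3.4 /
3.5(ii)).** For a well-formed family `G` with nondegenerate divisor `G i₀` and a scaled limit
`lim (λ · Σ_i G_i) = f`: the divisor's unit normal form `G i₀ = c · U`, `lim U = u ≠ 0`, the
Claim-3.8 datum `lim (λc · (Σ_i G_i)/G_{i₀}) = f/u`, and the next scaled limit
`lim (λc · Σ_i E(G_i/G_{i₀})) = E(f/u)`.
[cite: DuttaDwivediSaxena2022, §3 proof of Thm. 3.2, Divide and Derive (3.2) (full version p0030 L808–812); Claim 3.4 (p0029 L772–785); Claim 3.5(ii) (p0031 L819–834)] -/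
theorem didil_round {m : ℕ} (G : Fin (m + 1) → ExactTerm (RatFunc F) n) (hG : ∀ i, (G i).WF)
    (i₀ : Fin (m + 1)) (hND : (G i₀).ND) (lam : RatFunc F)
    {f : FractionRing (MvPolynomial (Fin n) F)}
    (h : EpsLim (algebraMap (RatFunc F) (FractionRing (MvPolynomial (Fin n) (RatFunc F))) lam *
      ∑ i, (G i).val) f) :
    ∃ (c : RatFunc F) (U : FractionRing (MvPolynomial (Fin n) (RatFunc F)))
      (u : FractionRing (MvPolynomial (Fin n) F)), c ≠ 0 ∧ u ≠ 0 ∧ EpsLim U u ∧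
      (G i₀).val = algebraMap (RatFunc F) (FractionRing (MvPolynomial (Fin n) (RatFunc F))) c * U ∧
      EpsLim (algebraMap (RatFunc F) (FractionRing (MvPolynomial (Fin n) (RatFunc F))) (lam * c) *
          (∑ i, (G i).val) / (G i₀).val) (f / u) ∧
      EpsLim (algebraMap (RatFunc F) (FractionRing (MvPolynomial (Fin n) (RatFunc F))) (lam * c) *
          ∑ i, (didilStep (euler (Fin n) (RatFunc F)) G i₀ i).val)
        (eulerFrac (Fin n) F (FractionRing (MvPolynomial (Fin n) F)) (f / u)) := by
  obtain ⟨c, U, u, hc, hu, hU, hT⟩ := exists_unit_divisor ((G i₀).val_ne_zero (hG i₀) hND)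
  have hcL : algebraMap (RatFunc F) (FractionRing (MvPolynomial (Fin n) (RatFunc F))) c ≠ 0 :=
    (map_ne_zero _).mpr hc
  have hU0 : U ≠ 0 := by
    rintro rfl
    exact (G i₀).val_ne_zero (hG i₀) hND (by rw [hT, mul_zero])
  have hY : algebraMap (RatFunc F) (FractionRing (MvPolynomial (Fin n) (RatFunc F))) (lam * c) *
        (∑ i, (G i).val) / (G i₀).val =
      (algebraMap (RatFunc F) (FractionRing (MvPolynomial (Fin n) (RatFunc F))) lam *
        ∑ i, (G i).val) / U := by
    rw [hT, map_mul]
    field_simp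
  have hYlim : EpsLim (algebraMap (RatFunc F) (FractionRing (MvPolynomial (Fin n) (RatFunc F)))
      (lam * c) * (∑ i, (G i).val) / (G i₀).val) (f / u) := by
    rw [hY]
    exact h.div hU hu
  refine ⟨c, U, u, hc, hu, hU, hT, hYlim, ?_⟩
  rw [sum_val_didilStep_euler G hG i₀ hND, ← derivation_algebraMap_mul, ← mul_div_assoc]
  exact hYlim.eulerFrac

/-- **The DiDIL run (transcript skeleton, `F(x)` side).** From `m` well-formed exact terms over
`F(ε)` of size `≤ B`, `Σ∧Σ`-certified below degree `N` with budget `t`, and a scaled limit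
`lim (λ · Σ_i G_i) = f_0` (`λ ≠ 0`), there are `r ≤ m − 1` rounds with, BY NAME: stage families
`Fam j` (`Fam 0 = G`, `Fam (j+1) =` the DiDIL step of `Fam j` at a nondegenerate divisor index),
scalars `λ_j` (`λ_0 = λ`, `λ_{j+1} = λ_j · c_j`), residues `f_j` (`f_0` given,
`f_{j+1} = E(f_j / u_j)`), the divisor's unit data (`G i₀ = c_j · U_j`, `lim U_j = u_j ≠ 0`), the
Claim-3.8 datum `lim (λ_j c_j · (Σ_i G_i)/G_{i₀}) = f_j / u_j`, the invariants (well-formed, size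
`B_j`, certificates `t_j`; `B_{j+1} = 20 B_j`, `t_{j+1} = (4B_j+2) N⁸ t_j⁴`, Claim 3.6) and the
scaled limits `lim (λ_j · Σ_i (Fam j)_i) = f_j` at every stage `j ≤ r`; and the END STATE: either a
single term is left (`Fam r = (T)`, so `lim (λ_r · T) = f_r`: the input of the end game
`ExactTerm.uabp_residue(_scaled)`, Claim 3.3), or `f_r = 0`.
[cite: DuttaDwivediSaxena2022, §3 proof of Thm. 3.2, the induction "Reducing Gen(k−j,·) to Gen(k−j−1,·)", j = 0,…,k−2 (full version p0030 L797–812), Claims 3.4–3.6 (p0029 L772 – p0033 L890), end of the induction (p0033 L891 – p0034 L897)] -/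
theorem exists_didil_run [CharZero F] (N : ℕ) :
    ∀ (m : ℕ) (G : Fin m → ExactTerm (RatFunc F) n), (∀ i, (G i).WF) →
      ∀ {B t : ℕ}, (∀ i, (G i).Bdd B) → (∀ i, (G i).Cert N t) →
      ∀ {lam : RatFunc F}, lam ≠ 0 → ∀ {f₀ : FractionRing (MvPolynomial (Fin n) F)},
      EpsLim (algebraMap (RatFunc F) (FractionRing (MvPolynomial (Fin n) (RatFunc F))) lam *
        ∑ i, (G i).val) f₀ →
      ∃ (r : ℕ) (Fam : ℕ → (Σ m' : ℕ, Fin m' → ExactTerm (RatFunc F) n)) (lamS : ℕ → RatFunc F)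
        (f : ℕ → FractionRing (MvPolynomial (Fin n) F)) (Bs ts : ℕ → ℕ),
        r + 1 ≤ max m 1 ∧ Fam 0 = ⟨m, G⟩ ∧ f 0 = f₀ ∧ lamS 0 = lam ∧ Bs 0 = B ∧ ts 0 = t ∧
        (∀ j, j < r → ∃ (m' : ℕ) (G' : Fin (m' + 1) → ExactTerm (RatFunc F) n) (i₀ : Fin (m' + 1))
            (c : RatFunc F) (U : FractionRing (MvPolynomial (Fin n) (RatFunc F)))
            (u : FractionRing (MvPolynomial (Fin n) F)),
          Fam j = ⟨m' + 1, G'⟩ ∧ Fam (j + 1) = ⟨m', didilStep (euler (Fin n) (RatFunc F)) G' i₀⟩ ∧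
          (G' i₀).ND ∧ c ≠ 0 ∧
          (G' i₀).val = algebraMap (RatFunc F) (FractionRing (MvPolynomial (Fin n) (RatFunc F))) c * U ∧
          EpsLim U u ∧ u ≠ 0 ∧ lamS (j + 1) = lamS j * c ∧
          f (j + 1) = eulerFrac (Fin n) F (FractionRing (MvPolynomial (Fin n) F)) (f j / u) ∧
          EpsLim (algebraMap (RatFunc F) (FractionRing (MvPolynomial (Fin n) (RatFunc F)))
              (lamS j * c) * (∑ i, (G' i).val) / (G' i₀).val) (f j / u) ∧
          Bs (j + 1) = 20 * Bs j ∧ ts (j + 1) = (4 * Bs j + 2) * N ^ 8 * ts j ^ 4) ∧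
        (∀ j, j ≤ r → lamS j ≠ 0 ∧
          EpsLim (algebraMap (RatFunc F) (FractionRing (MvPolynomial (Fin n) (RatFunc F))) (lamS j) *
            ∑ i, ((Fam j).2 i).val) (f j) ∧
          ∀ i, ((Fam j).2 i).WF ∧ ((Fam j).2 i).Bdd (Bs j) ∧ ((Fam j).2 i).Cert N (ts j)) ∧
        ((∃ T : ExactTerm (RatFunc F) n, Fam r = ⟨1, fun _ => T⟩) ∨ f r = 0) := by
  intro m
  induction m with
  | zero =>
    intro G hWF B t hB hC lam hlam f₀ h0
    refine ⟨0, fun _ => ⟨0, G⟩, fun _ => lam, fun _ => f₀, fun _ => B, fun _ => t, by simp, rfl, rfl,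
      rfl, rfl, rfl, fun j hj => absurd hj (Nat.not_lt_zero j), fun j hj => ?_, Or.inr ?_⟩
    · obtain rfl := Nat.le_zero.mp hj
      exact ⟨hlam, h0, fun i => ⟨hWF i, hB i, hC i⟩⟩
    · rw [Finset.univ_eq_empty, Finset.sum_empty, mul_zero] at h0
      exact (epsLim_zero.unique h0).symm
  | succ m ih =>
    intro G hWF B t hB hC lam hlam f₀ h0
    by_cases hlive : 1 ≤ m ∧ ∃ i₀, (G i₀).ND
    · obtain ⟨hm, i₀, hND⟩ := hlive
      obtain ⟨c₀, U₀, u₀, hc₀, hu₀, hU₀, hT₀, hY₀, hnext⟩ := didil_round G hWF i₀ hND lam h0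
      haveI : CharZero (RatFunc F) :=
        charZero_of_injective_algebraMap (algebraMap F (RatFunc F)).injective
      have hWF' : ∀ i, (didilStep (euler (Fin n) (RatFunc F)) G i₀ i).WF := fun i =>
        wf_didilStep _ hWF hND i
      have hB' : ∀ i, (didilStep (euler (Fin n) (RatFunc F)) G i₀ i).Bdd (20 * B) := fun i =>
        bdd_didilStep degLE_euler hB i₀ i
      have hC' : ∀ i, (didilStep (euler (Fin n) (RatFunc F)) G i₀ i).Cert N
          ((4 * B + 2) * N ^ 8 * t ^ 4) := fun i => cert_didilStep hC hB i₀ i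
      obtain ⟨r', Fam', lamS', f', Bs', ts', hr', hFam0, hf0, hlam0, hBs0, hts0, hround, hinv, hend⟩ :=
        ih (didilStep (euler (Fin n) (RatFunc F)) G i₀) hWF' hB' hC' (mul_ne_zero hlam hc₀) hnext
      refine ⟨r' + 1,
        (fun j => match j with | 0 => ⟨m + 1, G⟩ | j + 1 => Fam' j),
        (fun j => match j with | 0 => lam | j + 1 => lamS' j),
        (fun j => match j with | 0 => f₀ | j + 1 => f' j),
        (fun j => match j with | 0 => B | j + 1 => Bs' j),
        (fun j => match j with | 0 => t | j + 1 => ts' j),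
        by omega, rfl, rfl, rfl, rfl, rfl, fun j hj => ?_, fun j hj => ?_, hend⟩
      · rcases j with _ | j
        · exact ⟨m, G, i₀, c₀, U₀, u₀, rfl, hFam0, hND, hc₀, hT₀, hU₀, hu₀, hlam0, hf0, hY₀, hBs0, hts0⟩
        · exact hround j (by omega)
      · rcases j with _ | j
        · exact ⟨hlam, h0, fun i => ⟨hWF i, hB i, hC i⟩⟩
        · exact hinv j (by omega)
    · -- stop: a single term, or no live divisor among `m + 1 ≥ 2` terms
      refine ⟨0, fun _ => ⟨m + 1, G⟩, fun _ => lam, fun _ => f₀, fun _ => B, fun _ => t, by omega, rfl,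
        rfl, rfl, rfl, rfl, fun j hj => absurd hj (Nat.not_lt_zero j), fun j hj => ?_, ?_⟩
      · obtain rfl := Nat.le_zero.mp hj
        exact ⟨hlam, h0, fun i => ⟨hWF i, hB i, hC i⟩⟩
      · rcases Nat.eq_zero_or_pos m with hm | hm
        · subst hm
          refine Or.inl ⟨G 0, ?_⟩
          have hG1 : G = fun _ => G 0 := funext fun i => by rw [Fin.fin_one_eq_zero i]
          exact congrArg (Sigma.mk 1) hG1
        · refine Or.inr ?_
          have hdeg : ∀ i, ¬ (G i).ND := fun i hi => hlive ⟨hm, i, hi⟩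
          have hsum : ∑ i, (G i).val = 0 :=
            Finset.sum_eq_zero fun i _ => ((G i).val_eq_zero_iff (hWF i)).mpr (hdeg i)
          rw [hsum, mul_zero] at h0
          exact (epsLim_zero.unique h0).symm

/-- The run from STAGE 0 (`exists_stageZero_epsLim`: `m ≤ k` live products, size `≤ d`, trivial
certificates, `lim Σ = f♯`): `r ≤ k − 1` rounds, `λ_0 = 1`, `B_j = 20^j · d`.
[cite: DuttaDwivediSaxena2022, §3 proof of Thm. 3.2, base case and induction (full version p0028 L745 – p0030 L812), Claim 3.6 (p0033 L880–890)] -/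
theorem exists_didil_run_stageZero [CharZero F] (N : ℕ) {k d : ℕ}
    (T : Fin k → Fin d → Option (Fin n) → RatFunc F)
    (h0 : ∀ i j, affForm (T i j) ≠ 0 → T i j none ≠ 0) {fs : MvPolynomial (Fin n) F}
    (hf : MS2021.IsEpsApprox fs (∑ i, ∏ j, affForm (T i j))) :
    ∃ (m : ℕ) (G : Fin m → ExactTerm (RatFunc F) n) (r : ℕ)
      (Fam : ℕ → (Σ m' : ℕ, Fin m' → ExactTerm (RatFunc F) n)) (lamS : ℕ → RatFunc F)
      (f : ℕ → FractionRing (MvPolynomial (Fin n) F)) (Bs ts : ℕ → ℕ),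
      m ≤ k ∧ r + 1 ≤ max m 1 ∧ Fam 0 = ⟨m, G⟩ ∧ f 0 = limToFrac F (Fin n) fs ∧ lamS 0 = 1 ∧
      Bs 0 = d ∧ ts 0 = 1 ∧ (∀ i, (G i).ND) ∧
      (∀ j, j < r → ∃ (m' : ℕ) (G' : Fin (m' + 1) → ExactTerm (RatFunc F) n) (i₀ : Fin (m' + 1))
          (c : RatFunc F) (U : FractionRing (MvPolynomial (Fin n) (RatFunc F)))
          (u : FractionRing (MvPolynomial (Fin n) F)),
        Fam j = ⟨m' + 1, G'⟩ ∧ Fam (j + 1) = ⟨m', didilStep (euler (Fin n) (RatFunc F)) G' i₀⟩ ∧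
        (G' i₀).ND ∧ c ≠ 0 ∧
        (G' i₀).val = algebraMap (RatFunc F) (FractionRing (MvPolynomial (Fin n) (RatFunc F))) c * U ∧
        EpsLim U u ∧ u ≠ 0 ∧ lamS (j + 1) = lamS j * c ∧
        f (j + 1) = eulerFrac (Fin n) F (FractionRing (MvPolynomial (Fin n) F)) (f j / u) ∧
        EpsLim (algebraMap (RatFunc F) (FractionRing (MvPolynomial (Fin n) (RatFunc F)))
            (lamS j * c) * (∑ i, (G' i).val) / (G' i₀).val) (f j / u) ∧
        Bs (j + 1) = 20 * Bs j ∧ ts (j + 1) = (4 * Bs j + 2) * N ^ 8 * ts j ^ 4) ∧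
      (∀ j, j ≤ r → lamS j ≠ 0 ∧
        EpsLim (algebraMap (RatFunc F) (FractionRing (MvPolynomial (Fin n) (RatFunc F))) (lamS j) *
          ∑ i, ((Fam j).2 i).val) (f j) ∧
        ∀ i, ((Fam j).2 i).WF ∧ ((Fam j).2 i).Bdd (Bs j) ∧ ((Fam j).2 i).Cert N (ts j)) ∧
      ((∃ T' : ExactTerm (RatFunc F) n, Fam r = ⟨1, fun _ => T'⟩) ∨ f r = 0) := by
  obtain ⟨m, G, hm, hG, hlim⟩ := exists_stageZero_epsLim T h0 hf
  have h1 : EpsLim (algebraMap (RatFunc F) (FractionRing (MvPolynomial (Fin n) (RatFunc F))) 1 *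
      ∑ i, (G i).val) (limToFrac F (Fin n) fs) := by
    rwa [map_one, one_mul]
  obtain ⟨r, Fam, lamS, f, Bs, ts, hr, hFam0, hf0, hlam0, hBs0, hts0, hround, hinv, hend⟩ :=
    exists_didil_run N m G (fun i => (hG i).1) (fun i => (hG i).2.2.1) (fun i => (hG i).2.2.2 N)
      one_ne_zero h1
  exact ⟨m, G, r, Fam, lamS, f, Bs, ts, hm, hr, hFam0, hf0, hlam0, hBs0, hts0, fun i => (hG i).2.1,
    hround, hinv, hend⟩

end Run

/-! ### Invariants along the run

Any stagewise predicate preserved by one DiDIL step at a nondegenerate divisor holds at every stage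
of the run — the vehicle by which the `ε`-regularity of the form lists (`ExactTerm.FormsSat`,
`DDS21DiDILStep.lean` v3) and the companion / weight invariant of `DDS21DiDILCompanion.lean`
(`StageComp`) travel from stage `0` to the divisor terms and the end state. -/

section Invariant

variable {K : Type*} [Field K] {n : ℕ}

/-- **Propagation of a stagewise invariant along a DiDIL run.** If `P 0` holds for the initial
family and `P j ⟨m'+1, G'⟩ ⇒ P (j+1) ⟨m', didilStep G' i₀⟩` at every nondegenerate divisor, then
`P j (Fam j)` for all `j ≤ r` (the rounds being given, as in `exists_didil_run`, by
`Fam (j+1) = ⟨m', didilStep (Fam j) i₀⟩`). Induction hypotheses (2)–(3) of the printed induction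
are carried this way. [cite: DuttaDwivediSaxena2022, §3 proof of Thm. 3.2, induction hypotheses (1)–(3) (full version p0030 L799–805)] -/
theorem run_invariant (P : ℕ → (Σ m' : ℕ, Fin m' → ExactTerm K n) → Prop) {r : ℕ}
    {Fam : ℕ → (Σ m' : ℕ, Fin m' → ExactTerm K n)}
    (hstep : ∀ j, j < r → ∃ (m' : ℕ) (G' : Fin (m' + 1) → ExactTerm K n) (i₀ : Fin (m' + 1)),
      Fam j = ⟨m' + 1, G'⟩ ∧ Fam (j + 1) = ⟨m', didilStep (euler (Fin n) K) G' i₀⟩ ∧ (G' i₀).ND)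
    (h0 : P 0 (Fam 0))
    (hP : ∀ (j m' : ℕ) (G' : Fin (m' + 1) → ExactTerm K n) (i₀ : Fin (m' + 1)), j < r →
      P j ⟨m' + 1, G'⟩ → (G' i₀).ND → P (j + 1) ⟨m', didilStep (euler (Fin n) K) G' i₀⟩) :
    ∀ j, j ≤ r → P j (Fam j) := by
  intro j
  induction j with
  | zero => exact fun _ => h0
  | succ j ih =>
    intro hj
    obtain ⟨m', G', i₀, hFj, hFj1, hND⟩ := hstep j (Nat.lt_of_succ_le hj)
    rw [hFj1]
    exact hP j m' G' i₀ (Nat.lt_of_succ_le hj) (hFj ▸ ih (Nat.le_of_succ_le hj)) hND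

/-- Uniform (stage-independent) form of `run_invariant`. [cite: DuttaDwivediSaxena2022, §3 proof of Thm. 3.2, induction hypotheses (1)–(3) (full version p0030 L799–805)] -/
theorem run_invariant' (Q : (Σ m' : ℕ, Fin m' → ExactTerm K n) → Prop) {r : ℕ}
    {Fam : ℕ → (Σ m' : ℕ, Fin m' → ExactTerm K n)}
    (hstep : ∀ j, j < r → ∃ (m' : ℕ) (G' : Fin (m' + 1) → ExactTerm K n) (i₀ : Fin (m' + 1)),
      Fam j = ⟨m' + 1, G'⟩ ∧ Fam (j + 1) = ⟨m', didilStep (euler (Fin n) K) G' i₀⟩ ∧ (G' i₀).ND)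
    (h0 : Q (Fam 0))
    (hQ : ∀ (m' : ℕ) (G' : Fin (m' + 1) → ExactTerm K n) (i₀ : Fin (m' + 1)),
      Q ⟨m' + 1, G'⟩ → (G' i₀).ND → Q ⟨m', didilStep (euler (Fin n) K) G' i₀⟩) :
    ∀ j, j ≤ r → Q (Fam j) :=
  run_invariant (fun _ => Q) hstep h0 fun _ m' G' i₀ _ h hND => hQ m' G' i₀ h hND

/-- Termwise predicates: if `R` holds for every term of the initial family and one DiDIL step at a
nondegenerate divisor preserves "`R` for every term" (e.g. `R = ExactTerm.FormsSat P` by the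
provenance lemmas of `DDS21DiDILStep.lean`), then every term of every stage satisfies `R`.
[cite: DuttaDwivediSaxena2022, §3 proof of Thm. 3.2, induction hypothesis (3) "U_{i,j}|_{z=0} ∈ F(ε)∖{0}" (full version p0030 L804–805)] -/
theorem run_invariant_termwise (R : ExactTerm K n → Prop) {r : ℕ}
    {Fam : ℕ → (Σ m' : ℕ, Fin m' → ExactTerm K n)}
    (hstep : ∀ j, j < r → ∃ (m' : ℕ) (G' : Fin (m' + 1) → ExactTerm K n) (i₀ : Fin (m' + 1)),
      Fam j = ⟨m' + 1, G'⟩ ∧ Fam (j + 1) = ⟨m', didilStep (euler (Fin n) K) G' i₀⟩ ∧ (G' i₀).ND)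
    (h0 : ∀ i, R ((Fam 0).2 i))
    (hR : ∀ (m' : ℕ) (G' : Fin (m' + 1) → ExactTerm K n) (i₀ : Fin (m' + 1)), (∀ i, R (G' i)) →
      (G' i₀).ND → ∀ i, R (didilStep (euler (Fin n) K) G' i₀ i)) :
    ∀ j, j ≤ r → ∀ i, R ((Fam j).2 i) :=
  run_invariant' (fun S => ∀ i, R (S.2 i)) hstep h0 fun m' G' i₀ h hND => hR m' G' i₀ h hND

end Invariant

end DDS2021

end Literature.Computability.AlgebraicComplexity

end
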